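import Summits.RiemannHypothesis.RiemannHypothesis.Theses.LiDirichletAsymptotic
import Summits.RiemannHypothesis.RiemannHypothesis.Theorems.LiDirichletAsymptoticSmoothConductor
import Summits.RiemannHypothesis.RiemannHypothesis.Theorems.LiAsymptoticLiSmoothMainTerm
import Literature.NumberTheory.LFunctions.DirichletLZeroCountingParityProfile
import HarnessLib

/-!
# RiemannHypothesis / LiDirichletAsymptotic — crux K2χ `LiSmoothMainTermChar`: the SMOOTH MAIN TERM (RH-FREE · GRH-FREE)

RH-FREE · GRH-FREE PROOF-OF-DATA (rung L-P(P1⁺χ)) [rh-li-prover].  Route `Theses/LiDirichletAsymptotic.lean`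
(cell `pub/rh-li`, round 5 (iii)), item `LiSmoothMainTermChar` (stmt-RiemannHypothesis-19630): for a primitive `χ`
mod `q > 1`, `n ≥ 100`, `T' ≥ n²`,

  `|(2/π)∫_{√n}^{T'} f_n(t) g_χ(t) dt − (charLiMainTerm q n − charCountMainExact χ √n)| ≤ charErrSmooth q n`
  `= 2 log n + 2 log q + 3`,

`f_n = liWindowWeight n`, `g_χ(t) = ½ Re ψ((½+a+it)/2) + ½ log(q/π)` (`charGammaDensity`, `a = charParity χ`).
Proof (χ-TRANSFER of the closed ζ item 19162 `LiSmoothMainTerm`, used as a black box):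
`g_χ = ϑ' + ½ log q + δ_a` with `ϑ' = riemannSiegelThetaDeriv` and `δ_0 = 0`, `δ_1(t) = π/(2 cosh πt)`
(the tree's parity profile `re_logDeriv_Gammaℝ_line_one_sub_zero`), so
`(2/π)∫ f_n g_χ = (2/π)∫ f_n ϑ' + (log q/π)∫ f_n + (2/π)∫ f_n δ_a`; the first is `liMainTerm n − 2 liCountMain √n ±
(2 log n + 1)` (`liSmoothMainTerm_bound`); the CONDUCTOR CHANNEL `∫_{√n}^{T'} f_n = nπ/2 − √n ± 61/24` (model
`1 − cos(n/t)`, substitution `u = n/t`, `∫_0^∞ (1 − cos u)/u² = π/2` from the tree, tail by one integration by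
parts, `|f_n − (1 − cos(n/t))| ≤ n/(12t³)`); `0 ≤ (2/π)∫ f_n δ_a ≤ 8/(π²√n)`; and the EXACT boundary term
`charCountMainExact χ √n = (2θ_a(√n) + √n log q)/π` equals `2 liCountMain √n + (√n/π) log q ± 1.1/π` by the tree's
explicit Stirling brackets for `θ = θ_0` and `θ_1` (`abs_riemannSiegelTheta_sub_stirling_le`,
`abs_gammaArgPhase_one_sub_stirling_le`).  Total `≤ 2 log n + 1 + (61/24π) log q + 0.09 + 0.37 ≤ charErrSmooth q n`.
Nothing here bears on the truth of RH or GRH.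
-/

noncomputable section

-- D-0017: `Summit.<S>.<S>.…` is the designed namespace of a single-problem summit.
set_option linter.dupNamespace false

open MeasureTheory intervalIntegral Set Filter
open scoped Topology

namespace Summit.RiemannHypothesis.RiemannHypothesis.Theorems.LiTheory

open Literature.NumberTheory.LFunctions Literature.NumberTheory.LFunctions.DirichletTheta
open Complex (I)

namespace SmoothChar

/-! ### The density: `g_χ = Re (Γ_ℝ'/Γ_ℝ)(½ + a + it) + ½ log q = ϑ' + ½ log q + δ_a` -/

/-- `g_χ(t) = Re (Γ_ℝ'/Γ_ℝ)(½ + a + it) + ½ log q` (`Γ_ℝ(s) = π^{−s/2} Γ(s/2)`, `a = charParity χ`): the density of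
`(2/π)·charGammaDensity` is exactly `d/dt charCountMainExact` (cf. `hasDerivAt_gammaArgPhase`). -/
theorem charGammaDensity_eq {q : ℕ} [NeZero q] (χ : DirichletCharacter ℂ q) (t : ℝ) :
    charGammaDensity χ t =
      (logDeriv Complex.Gammaℝ (1 / 2 + (charParity χ : ℂ) + t * I)).re + Real.log q / 2 := by
  have hq : (0 : ℝ) < q := by exact_mod_cast Nat.pos_of_ne_zero (NeZero.ne q)
  rw [charGammaDensity, re_logDeriv_Gammaℝ_line_eq_digamma, Complex.digamma,
    Real.log_div hq.ne' Real.pi_pos.ne']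
  have e : ((1 : ℂ) / 2 + (charParity χ : ℂ) + (t : ℂ) * I) / 2 =
      1 / 4 + (charParity χ : ℂ) / 2 + (t : ℂ) / 2 * I := by ring
  rw [e]
  ring

/-- Even parity: `Re (Γ_ℝ'/Γ_ℝ)(½ + it) = ϑ'(t)` (Riemann–Siegel). -/
theorem re_logDeriv_Gammaℝ_parity_zero (t : ℝ) :
    (logDeriv Complex.Gammaℝ (1 / 2 + ((0 : ℕ) : ℂ) + t * I)).re = riemannSiegelThetaDeriv t := by
  have e : (1 / 2 : ℂ) + ((0 : ℕ) : ℂ) + t * I = ((1 / 2 : ℝ) : ℂ) + t * I := by push_cast; ring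
  rw [e]
  exact logDeriv_Gammaℝ_half_add_re t

/-- Odd parity: `Re (Γ_ℝ'/Γ_ℝ)(3/2 + it) = ϑ'(t) + π/(2 cosh πt)` (the tree's parity profile). -/
theorem re_logDeriv_Gammaℝ_parity_one (t : ℝ) :
    (logDeriv Complex.Gammaℝ (1 / 2 + ((1 : ℕ) : ℂ) + t * I)).re =
      riemannSiegelThetaDeriv t + Real.pi / (2 * Real.cosh (Real.pi * t)) := by
  have h := re_logDeriv_Gammaℝ_line_one_sub_zero t
  rw [re_logDeriv_Gammaℝ_parity_zero] at h
  linarith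

/-- `π/(2 cosh πt) ≤ 2/(π t²)` for `t > 0` (`cosh x ≥ 1 + x²/4`). -/
theorem pi_div_two_cosh_le {t : ℝ} (ht : 0 < t) :
    Real.pi / (2 * Real.cosh (Real.pi * t)) ≤ 2 / (Real.pi * t ^ 2) := by
  have hπ := Real.pi_pos
  have hx0 : 0 ≤ Real.pi * t := by positivity
  have hcosh : 1 + (Real.pi * t) ^ 2 / 4 ≤ Real.cosh (Real.pi * t) := by
    rw [Real.cosh_eq]
    have h1 := Real.quadratic_le_exp_of_nonneg hx0
    have h2 := Real.add_one_le_exp (-(Real.pi * t))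
    linarith
  have hc0 : 0 < Real.cosh (Real.pi * t) := Real.cosh_pos _
  rw [div_le_div_iff₀ (by positivity) (by positivity)]
  nlinarith

/-! ### Stirling bracket for the `Γ`-phase at the cut `a = √n ≥ 10`, both parities -/

/-- `|θ_κ(a) − ((a/2) log(a/2π) − a/2)| ≤ 0.55` for `κ ∈ {0, 1}`, `a ≥ 10` (the parity constants `∓π/8` plus the
explicit Stirling remainders `2K(¼)/a (+ 1/(2 sinh πa))` of the tree). -/
theorem abs_gammaArgPhase_sub_main_le {κ : ℕ} (hκ : κ = 0 ∨ κ = 1) {a : ℝ} (ha : 10 ≤ a) :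
    |gammaArgPhase κ a - (a / 2 * Real.log (a / (2 * Real.pi)) - a / 2)| ≤ 0.55 := by
  have hπ3 := Real.pi_gt_three
  have hπ4 := Real.pi_lt_d2
  have hK := Window.two_stirlingVertRate_le
  have ha2 : 2 ≤ a := by linarith
  have ha0 : 0 < a := by linarith
  have hKa : 2 * stirlingVertRate (1 / 4) / a ≤ 0.118 := by
    rw [div_le_iff₀ ha0]; nlinarith
  rcases hκ with h | h
  · subst h
    rw [gammaArgPhase_zero]
    have h0 := abs_riemannSiegelTheta_sub_stirling_le ha2
    obtain ⟨h1, h2⟩ := abs_le.1 h0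
    rw [abs_le]; constructor <;> linarith
  · subst h
    have h0 := abs_gammaArgPhase_one_sub_stirling_le ha2
    have hs : 1 / (2 * Real.sinh (Real.pi * a)) ≤ 0.02 := by
      have hx : Real.pi * a ≤ Real.sinh (Real.pi * a) := Real.self_le_sinh_iff.2 (by positivity)
      have h30 : (30 : ℝ) ≤ Real.sinh (Real.pi * a) := by nlinarith
      rw [div_le_iff₀ (by positivity)]; nlinarith
    obtain ⟨h1, h2⟩ := abs_le.1 h0
    rw [abs_le]; constructor <;> linarith

end SmoothChar

open SmoothChar in
/-- **Crux K2χ `LiSmoothMainTermChar`** (stmt-RiemannHypothesis-19630; RH-FREE · GRH-FREE): for `χ` mod `q > 1`,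
`n ≥ 100`, `T' ≥ n²`,
`|(2/π)∫_{√n}^{T'} f_n g_χ − (charLiMainTerm q n − charCountMainExact χ √n)| ≤ charErrSmooth q n = 2 log n + 2 log q + 3`.
(Primitivity is not used; the bound proved is `2 log n + 1 + (61/24π) log q + 0.09 + 0.37`.) -/
theorem liSmoothMainTermChar_bound (q : ℕ) [NeZero q] (χ : DirichletCharacter ℂ q) (hq : 1 < q)
    (n : ℕ) (T' : ℝ) (hn : 100 ≤ n) (hT' : (n : ℝ) ^ 2 ≤ T') :
    |2 / Real.pi * (∫ t in Real.sqrt n..T', liWindowWeight n t * charGammaDensity χ t) -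
        (charLiMainTerm q n - charCountMainExact χ (Real.sqrt n))| ≤ charErrSmooth q n := by
  have hπ := Real.pi_pos
  have hπ3 := Real.pi_gt_three
  have hnR : (100 : ℝ) ≤ n := by exact_mod_cast hn
  have hn1 : 1 ≤ n := le_trans (by norm_num) hn
  have hn0 : (0 : ℝ) < n := by linarith
  have hqR : (1 : ℝ) < q := by exact_mod_cast hq
  have hlogq : 0 ≤ Real.log q := Real.log_nonneg hqR.le
  have hlogn : 0 ≤ Real.log n := Real.log_nonneg (by linarith)
  -- the ζ black box (item 19162) and the conductor channel, stated at `√n`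
  have hZ := liSmoothMainTerm_bound n T' hn hT'
  have hQ := abs_conductor_channel n T' hn1 hT'
  simp only [liErrSmooth] at hZ
  set a := Real.sqrt n with ha
  have haa : a ^ 2 = n := by rw [ha, Real.sq_sqrt hn0.le]
  have ha10 : 10 ≤ a := by
    have h10 : Real.sqrt ((10 : ℝ) ^ 2) = 10 := Real.sqrt_sq (by norm_num)
    rw [ha, ← h10]
    exact Real.sqrt_le_sqrt (by linarith)
  have ha0 : 0 < a := by linarith
  have haT : a ≤ T' := by nlinarith
  have hT0 : 0 < T' := by linarith
  have hne : ∀ t ∈ uIcc a T', t ≠ 0 := fun t ht ↦ by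
    rw [uIcc_of_le haT] at ht; exact (lt_of_lt_of_le ha0 ht.1).ne'
  -- parity
  have hκ : charParity χ = 0 ∨ charParity χ = 1 := by
    rcases χ.even_or_odd with h | h
    · exact Or.inl (charParity_of_even h)
    · exact Or.inr (charParity_of_odd h)
  -- the parity correction `δ = g_χ − ϑ' − ½ log q`
  set δ : ℝ → ℝ := fun t ↦ charGammaDensity χ t - riemannSiegelThetaDeriv t - Real.log q / 2 with hδdef
  have hδ : ∀ t : ℝ, 0 < t → 0 ≤ δ t ∧ δ t ≤ 2 / (Real.pi * t ^ 2) := by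
    intro t ht
    have e : δ t = (logDeriv Complex.Gammaℝ (1 / 2 + (charParity χ : ℂ) + t * I)).re -
        riemannSiegelThetaDeriv t := by
      simp only [hδdef, charGammaDensity_eq]; ring
    rcases hκ with h | h
    · rw [e, h, re_logDeriv_Gammaℝ_parity_zero, sub_self]
      exact ⟨le_rfl, by positivity⟩
    · rw [e, h, re_logDeriv_Gammaℝ_parity_one, add_sub_cancel_left]
      exact ⟨by positivity, pi_div_two_cosh_le ht⟩
  -- continuity / integrability on `[a, T']`
  have hfc : ContinuousOn (liWindowWeight n) (uIcc a T') := SmoothReplace.continuousOn_liWindowWeight n hne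
  have hϑc : Continuous riemannSiegelThetaDeriv := continuous_riemannSiegelThetaDeriv_holds
  have hgc : Continuous (charGammaDensity χ) := by
    have e : charGammaDensity χ =
        fun t : ℝ ↦ (logDeriv Complex.Gammaℝ (1 / 2 + (charParity χ : ℂ) + (t : ℂ) * I)).re + Real.log q / 2 :=
      funext fun t ↦ charGammaDensity_eq χ t
    rw [e]
    exact (continuous_re_logDeriv_Gammaℝ_line _).add continuous_const
  have hδc : Continuous δ := (hgc.sub hϑc).sub continuous_const
  have hi1 : IntervalIntegrable (fun t ↦ liWindowWeight n t * riemannSiegelThetaDeriv t) volume a T' :=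
    (hfc.mul hϑc.continuousOn).intervalIntegrable
  have hi2 : IntervalIntegrable (fun t ↦ Real.log q / 2 * liWindowWeight n t) volume a T' :=
    (continuousOn_const.mul hfc).intervalIntegrable
  have hi3 : IntervalIntegrable (fun t ↦ liWindowWeight n t * δ t) volume a T' :=
    (hfc.mul hδc.continuousOn).intervalIntegrable
  -- split the smooth integral into the three channels
  have hsplit : ∫ t in a..T', liWindowWeight n t * charGammaDensity χ t =
      (∫ t in a..T', liWindowWeight n t * riemannSiegelThetaDeriv t) +
        Real.log q / 2 * (∫ t in a..T', liWindowWeight n t) +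
        ∫ t in a..T', liWindowWeight n t * δ t := by
    have e1 : ∫ t in a..T', liWindowWeight n t * charGammaDensity χ t =
        ∫ t in a..T', (liWindowWeight n t * riemannSiegelThetaDeriv t +
          Real.log q / 2 * liWindowWeight n t) + liWindowWeight n t * δ t :=
      intervalIntegral.integral_congr fun t _ ↦ by simp only [hδdef]; ring
    rw [e1, intervalIntegral.integral_add (hi1.add hi2) hi3, intervalIntegral.integral_add hi1 hi2,
      intervalIntegral.integral_const_mul]
  -- the parity channel: `0 ≤ ∫ f_n δ ≤ 4/(π a)`
  have hΔ0 : 0 ≤ ∫ t in a..T', liWindowWeight n t * δ t :=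
    intervalIntegral.integral_nonneg haT fun t ht ↦
      mul_nonneg (SmoothReplace.liWindowWeight_mem n t).1 (hδ t (by linarith [ht.1])).1
  have hΔ1 : ∫ t in a..T', liWindowWeight n t * δ t ≤ 4 / (Real.pi * a) := by
    have hg : IntervalIntegrable (fun t : ℝ ↦ 4 / Real.pi * (1 / t ^ 2)) volume a T' := by
      refine ContinuousOn.intervalIntegrable (continuousOn_of_forall_continuousAt fun t ht ↦ ?_)
      have : t ^ 2 ≠ 0 := pow_ne_zero 2 (hne t ht)
      fun_prop (disch := assumption)
    calc ∫ t in a..T', liWindowWeight n t * δ t ≤ ∫ t in a..T', 4 / Real.pi * (1 / t ^ 2) :=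
          intervalIntegral.integral_mono_on haT hi3 hg fun t ht ↦ by
            have ht0 : 0 < t := by linarith [ht.1]
            obtain ⟨hf0, hf2⟩ := SmoothReplace.liWindowWeight_mem n t
            obtain ⟨hd0, hd1⟩ := hδ t ht0
            calc liWindowWeight n t * δ t ≤ 2 * (2 / (Real.pi * t ^ 2)) := mul_le_mul hf2 hd1 hd0 (by norm_num)
              _ = 4 / Real.pi * (1 / t ^ 2) := by field_simp; ring
      _ = 4 / Real.pi * (1 / a - 1 / T') := by
          rw [intervalIntegral.integral_const_mul, MeanSquareNearPeak.integral_inv_sq ha0 haT]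
      _ ≤ 4 / (Real.pi * a) := by
          have h1 : 0 ≤ 4 / Real.pi * (1 / T') := by positivity
          have e : 4 / (Real.pi * a) = 4 / Real.pi * (1 / a) := by field_simp
          rw [e]
          linarith
  -- the exact boundary term and the ζ counting main term
  have hB := abs_gammaArgPhase_sub_main_le hκ ha10
  have hM : charCountMainExact χ a =
      2 / Real.pi * gammaArgPhase (charParity χ) a + a * Real.log q / Real.pi := by
    unfold charCountMainExact; ring
  have hL : 2 * liCountMain a = 2 / Real.pi * (a / 2 * Real.log (a / (2 * Real.pi)) - a / 2) := by
    unfold liCountMain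
    have e : Real.log (a / (2 * Real.pi * Real.exp 1)) = Real.log (a / (2 * Real.pi)) - 1 := by
      rw [Real.log_div ha0.ne' (by positivity), Real.log_mul (by positivity) (Real.exp_pos 1).ne',
        Real.log_exp, Real.log_div ha0.ne' (by positivity)]
      ring
    rw [e]
    field_simp
  have hmain : charLiMainTerm q n = liMainTerm n + (n : ℝ) / 2 * Real.log q := by
    simp only [charLiMainTerm]
  -- the decomposition `E = Z + (log q/π) Q + (2/π) Δ + (2/π) B`
  have key : 2 / Real.pi * (∫ t in a..T', liWindowWeight n t * charGammaDensity χ t) -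
      (charLiMainTerm q n - charCountMainExact χ a) =
      (2 / Real.pi * (∫ t in a..T', liWindowWeight n t * riemannSiegelThetaDeriv t) -
          (liMainTerm n - 2 * liCountMain a)) +
        Real.log q / Real.pi * ((∫ t in a..T', liWindowWeight n t) - (n * Real.pi / 2 - a)) +
        2 / Real.pi * (∫ t in a..T', liWindowWeight n t * δ t) +
        2 / Real.pi * (gammaArgPhase (charParity χ) a - (a / 2 * Real.log (a / (2 * Real.pi)) - a / 2)) := by
    rw [hsplit, hmain, hM, hL]
    field_simp
    ring
  rw [key]
  -- numeric bounds for the three new channels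
  have hQ' : |Real.log q / Real.pi * ((∫ t in a..T', liWindowWeight n t) - (n * Real.pi / 2 - a))| ≤
      Real.log q := by
    rw [abs_mul, abs_of_nonneg (by positivity : 0 ≤ Real.log q / Real.pi)]
    calc Real.log q / Real.pi * |(∫ t in a..T', liWindowWeight n t) - (n * Real.pi / 2 - a)|
        ≤ Real.log q / Real.pi * (61 / 24) := mul_le_mul_of_nonneg_left hQ (by positivity)
      _ ≤ Real.log q := by
          rw [div_mul_eq_mul_div, div_le_iff₀ hπ]
          nlinarith [mul_nonneg hlogq (by linarith : (0 : ℝ) ≤ Real.pi - 61 / 24)]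
  have hΔ' : 2 / Real.pi * (∫ t in a..T', liWindowWeight n t * δ t) ≤ 0.09 := by
    have hπ2 : 9 ≤ Real.pi ^ 2 := by nlinarith
    have h90 : 90 ≤ Real.pi ^ 2 * a := by nlinarith
    calc 2 / Real.pi * (∫ t in a..T', liWindowWeight n t * δ t) ≤ 2 / Real.pi * (4 / (Real.pi * a)) :=
          mul_le_mul_of_nonneg_left hΔ1 (by positivity)
      _ = 8 / (Real.pi ^ 2 * a) := by field_simp; ring
      _ ≤ 0.09 := by rw [div_le_iff₀ (by positivity)]; linarith
  have hΔ'' : 0 ≤ 2 / Real.pi * (∫ t in a..T', liWindowWeight n t * δ t) :=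
    mul_nonneg (by positivity) hΔ0
  have hB' : |2 / Real.pi * (gammaArgPhase (charParity χ) a - (a / 2 * Real.log (a / (2 * Real.pi)) - a / 2))|
      ≤ 0.37 := by
    rw [abs_mul, abs_of_nonneg (by positivity : 0 ≤ 2 / Real.pi)]
    calc 2 / Real.pi * |gammaArgPhase (charParity χ) a - (a / 2 * Real.log (a / (2 * Real.pi)) - a / 2)|
        ≤ 2 / Real.pi * 0.55 := mul_le_mul_of_nonneg_left hB (by positivity)
      _ ≤ 0.37 := by
          rw [div_mul_eq_mul_div, div_le_iff₀ hπ]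
          norm_num
          linarith
  obtain ⟨h1, h2⟩ := abs_le.1 hZ
  obtain ⟨h3, h4⟩ := abs_le.1 hQ'
  obtain ⟨h5, h6⟩ := abs_le.1 hB'
  unfold charErrSmooth
  rw [abs_le]; constructor <;> linarith

/-- **Item `LiSmoothMainTermChar` of route `LiDirichletAsymptotic`** (stmt-RiemannHypothesis-19630), closed BY NAME. -/
theorem liSmoothMainTermChar_proof :
    Summit.RiemannHypothesis.RiemannHypothesis.Theses.LiDirichletAsymptotic.LiSmoothMainTermChar :=
  fun q _ χ _ hq n T' hn hT' ↦ liSmoothMainTermChar_bound q χ hq n T' hn hT'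

end Summit.RiemannHypothesis.RiemannHypothesis.Theorems.LiTheory

end
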